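import Literature.AlgebraicGeometry.Resolution.RegularTensorTower
import Literature.AlgebraicGeometry.Resolution.FormalFibresProofs
import Mathlib.RingTheory.Derivation.MapCoeffs
import Mathlib.RingTheory.PolynomialAlgebra
import Mathlib.RingTheory.IsTensorProduct
import Mathlib.RingTheory.RegularLocalRing.Polynomial
import HarnessLib

/-!
# Stacks 07PR for polynomial rings: `L ⊗_A (A[x]_Q)^` is regular
# (the characteristic-`p` kernel of Grothendieck's theorem 07PV)

Topic: `Literature/AlgebraicGeometry/Resolution`. For a complete regular local ring `A` with
fraction field `K`, a prime `Q` of `A[x]`, `Ŝ = (A[x]_Q)^` and a finite extension `L/K`, the ring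
`L ⊗_A Ŝ` is regular. This is the argument of The Stacks Project, Tag 07PR (Lemma 15.51.5, there
for `A = k⟦x_1, …, x_n⟧[y_1, …, y_m]` and the generic formal fibre), run with the base ring `A`
and the `A`-algebra `Ŝ`: `K ⊗_A Ŝ` is a localisation of the regular ring `Ŝ`; separable steps are
harmless; a radical step `F ⊂ F(a^{1/p})` needs a derivation `𝔇` of `F ⊗_A Ŝ` with `𝔇(a)` a unit,
obtained from a derivation `D` of a finite `A`-subalgebra `B ⊆ F` with `D(r^p a) ≠ 0` (Stacks
07PH, PROVED in the tree: `Stacks07PH_finite_regular_holds`) by transporting `D` coefficientwise to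
`A[x] → B[x]`, to `A[x]_Q`, to `Ŝ` (Stacks 07PE) and gluing with the extension of `D` to `F`
(`FormalFibresRegularDerivations.lean`, `DerivationCompletion.lean`). The tower induction is
`RegularTensorTower.lean`. Everything is PROVED; no new notions, no named facts.

This "semi-generic" regularity (tensoring over `A` with finite extensions of `Frac A`, rather than
over `A[x]` with finite extensions of `Frac A[x]`) is the common input of both remaining cases of
the kernel of 07PV in characteristic `p` (Tags 07PR with `m = 1` and 07PU).

## Content (namespace `Literature.AlgebraicGeometry.Resolution`)

* `exists_derivation_tensor_completion_of_extend` — transport of a derivation `D` of a finite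
  `R`-subalgebra `B ⊆ F = Frac B` to `F ⊗_R (R'_q)^` along `R → R'`, given the extension of `D|_R`
  to `R' → R' ⊗_R B` (generic in the intermediate ring `R'`).
* `exists_derivation_polynomial_extend` — that extension for `R' = R[x]` (coefficientwise).
* `exists_derivation_tensor_completion_polynomial_isUnit` — the derivation of a radical step.
* `isRegularRing_fractionRing_tensor_completion_polynomial` — `K ⊗_A (A[x]_Q)^` is regular.
* `isRegularRing_tensor_completion_polynomial` — **`L ⊗_A (A[x]_Q)^` is regular**.

## Sources

* The Stacks Project, Tags 07PR (Lemma 15.51.5, proof), 07PE, 07PG, 07PH. [StacksProject]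
* H. Matsumura, *Commutative Ring Theory*, CUP 1986, proof of Thm. 32.3, pp. 258–259.
  [Matsumura1987]
-/

noncomputable section

namespace Literature.AlgebraicGeometry.Resolution

universe u

open IsLocalRing TensorProduct Polynomial

/- As in `FormalFibresRegularDerivations.lean` and `DerivationCompletion.lean`: all `ℤ`-algebra
(`ℤ`-module) structures on a ring coincide, but adic completions, localisations and tensor products
carry their own instances; to keep the types of the `ℤ`-derivations uniform with those files we
give the generic instances priority here too — inside the section `IntInstances` only; the
final statements below are elaborated with the default instances (those of
`RegularTensorTower.lean`), re-packaging the derivations through their underlying additive maps. -/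
section IntInstances

attribute [local instance 1100] Ring.toIntAlgebra AddCommGroup.toIntModule

/-! ## Transport of derivations to `F ⊗_R (R'_q)^` -/

section Transport

variable (R : Type u) [CommRing R] (R' : Type u) [CommRing R'] [Algebra R R'] (q : Ideal R')
  [q.IsPrime] [IsNoetherianRing (Localization.AtPrime q)]
  (F : Type u) [Field F] [Algebra R F] (B : Subalgebra R F) [Module.Finite R B]
  [IsFractionRing B F]

/-- **Transport of a derivation of `B` to `F ⊗_R (R'_q)^` along `R → R'`** (Stacks 07PR/07PE, as in
`exists_derivation_tensor_completion` of `FormalFibresRegularDerivations.lean`, with an intermediate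
ring `R'`): given a derivation `D` of the finite `R`-subalgebra `B ⊆ F = Frac B` and an extension
`δ'` of `D|_R` to a derivation `R' → R' ⊗_R B`, there is a derivation `𝔇` of `F ⊗_R Ŝ`,
`Ŝ = (R'_q)^`, with `𝔇(b ⊗ 1) = D(b) ⊗ 1`: `δ'` extends to `S = R'_q → S ⊗_{R'} (R' ⊗_R B)`
(localisation), to `Ŝ → (S ⊗_{R'} (R' ⊗_R B))^ = Ŝ ⊗_R B → Ŝ ⊗_R F` (completion of a finite
module), and glues with the extension of `D` to `F`. [cite: StacksProject, Tag 07PR (proof)] -/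
theorem exists_derivation_tensor_completion_of_extend (D : Derivation ℤ B B)
    (δ' : Derivation ℤ R' (R' ⊗[R] B))
    (hδ' : ∀ r : R, δ' (algebraMap R R' r) = (1 : R') ⊗ₜ[R] D (algebraMap R B r)) :
    ∃ 𝔇 : Derivation ℤ (F ⊗[R] CompletionAtPrime R' q) (F ⊗[R] CompletionAtPrime R' q),
      ∀ b : B, 𝔇 ((b : F) ⊗ₜ[R] 1) = ((D b : B) : F) ⊗ₜ[R] 1 := by
  -- notation
  let S := Localization.AtPrime q
  let I := maximalIdeal S
  let Sh := CompletionAtPrime R' q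
  let N := R' ⊗[R] B
  -- (ii) extend `δ'` to `S → S ⊗_{R'} N`
  obtain ⟨δS, hδS⟩ := exists_derivation_extend_of_isLocalizedModule q.primeCompl S
    (TensorProduct.mk R' S N 1) δ'
  -- (iii) extend to the completions `Ŝ → (S ⊗_{R'} N)^`
  let δh := derivationAdicCompletion I δS
  -- (iv) `(S ⊗ N)^ ≅ Ŝ ⊗_S (S ⊗_{R'} N) ≅ Ŝ ⊗_{R'} N ≅ Ŝ ⊗_R B → Ŝ ⊗_R F`
  haveI : Module.Finite S (S ⊗[R'] N) := inferInstance
  let e₁ : AdicCompletion I (S ⊗[R'] N) ≃ₗ[Sh] Sh ⊗[S] (S ⊗[R'] N) :=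
    (AdicCompletion.ofTensorProductEquivOfFiniteNoetherian I (S ⊗[R'] N)).symm
  let e₂ : Sh ⊗[S] (S ⊗[R'] N) ≃ₗ[Sh] Sh ⊗[R'] N :=
    TensorProduct.AlgebraTensorModule.cancelBaseChange R' S Sh Sh N
  let e₃ : Sh ⊗[R'] N ≃ₗ[Sh] Sh ⊗[R] B :=
    TensorProduct.AlgebraTensorModule.cancelBaseChange R R' Sh Sh B
  let ι : Sh ⊗[R] B →ₗ[Sh] Sh ⊗[R] F := LinearMap.baseChange Sh B.val.toLinearMap
  let Λ : AdicCompletion I (S ⊗[R'] N) →ₗ[Sh] Sh ⊗[R] F :=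
    ι ∘ₗ e₃.toLinearMap ∘ₗ e₂.toLinearMap ∘ₗ e₁.toLinearMap
  -- (v) the derivation `Ŝ → Ŝ ⊗_R F`
  let dA := Λ.compDer δh
  -- (vi) extend `D` to `F = Frac B`
  obtain ⟨DF, hDF⟩ := exists_derivation_extend_of_isLocalization ℤ F (nonZeroDivisors B) D
  -- (vii) the two derivations agree on `R`
  have hΛ : ∀ b : B, Λ (AdicCompletion.of I (S ⊗[R'] N) ((1 : S) ⊗ₜ[R'] ((1 : R') ⊗ₜ[R] b))) =
      (1 : Sh) ⊗ₜ[R] (b : F) := fun b => by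
    change ι (e₃ (e₂ (e₁ (AdicCompletion.of I (S ⊗[R'] N) ((1 : S) ⊗ₜ[R'] ((1 : R') ⊗ₜ[R] b)))))) = _
    have h1 : e₁ (AdicCompletion.of I (S ⊗[R'] N) ((1 : S) ⊗ₜ[R'] ((1 : R') ⊗ₜ[R] b))) =
        (1 : Sh) ⊗ₜ[S] ((1 : S) ⊗ₜ[R'] ((1 : R') ⊗ₜ[R] b)) :=
      AdicCompletion.ofTensorProductEquivOfFiniteNoetherian_symm_of I (S ⊗[R'] N) _
    rw [h1, TensorProduct.AlgebraTensorModule.cancelBaseChange_tmul, one_smul,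
      TensorProduct.AlgebraTensorModule.cancelBaseChange_tmul, one_smul, LinearMap.baseChange_tmul]
    rfl
  have hcomp : ∀ r : R, dA (algebraMap R Sh r) = (1 : Sh) ⊗ₜ[R] DF (algebraMap R F r) := fun r => by
    change Λ (δh (algebraMap R Sh r)) = _
    rw [IsScalarTower.algebraMap_apply R R' Sh r, IsScalarTower.algebraMap_apply R' S Sh,
      derivationAdicCompletion_algebraMap, hδS, TensorProduct.mk_apply, hδ', hΛ,
      IsScalarTower.algebraMap_apply R B F r, hDF]
    rfl
  -- (viii) glue, (ix) transport along `Ŝ ⊗_R F ≅ F ⊗_R Ŝ`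
  let 𝔇₀ := tensorProductDerivation dA DF hcomp
  refine ⟨derivationOfRingEquiv (Algebra.TensorProduct.comm R Sh F).toRingEquiv 𝔇₀, fun b => ?_⟩
  rw [derivationOfRingEquiv_apply]
  change Algebra.TensorProduct.comm R Sh F
    (𝔇₀ ((Algebra.TensorProduct.comm R Sh F).symm ((b : F) ⊗ₜ[R] 1))) = _
  rw [Algebra.TensorProduct.comm_symm_tmul, tensorProductDerivation_one_tmul]
  change Algebra.TensorProduct.comm R Sh F ((1 : Sh) ⊗ₜ[R] DF (algebraMap B F b)) = _
  rw [hDF, Algebra.TensorProduct.comm_tmul]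
  rfl

end Transport

/-! ## The coefficientwise extension `R[x] → R[x] ⊗_R B` -/

section Coefficientwise

/-- **A derivation `D` of an `R`-algebra `B` extends coefficientwise along `R → R[x]`**: there is a
derivation `δ' : R[x] → R[x] ⊗_R B = B[x]` with `δ'(r) = 1 ⊗ D(r)` (and `δ'(x) = 0`), namely
`Σ aᵢ xⁱ ↦ Σ D(aᵢ) xⁱ` (Mathlib's `Differential.mapCoeffs` on `B[x]`, composed with `R[x] → B[x]`
and `B[x] ≅ R[x] ⊗_R B`). [folklore] -/
theorem exists_derivation_polynomial_extend (R : Type u) [CommRing R] (B : Type u) [CommRing B]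
    [Algebra R B] (D : Derivation ℤ B B) :
    ∃ δ' : Derivation ℤ R[X] (R[X] ⊗[R] B),
      ∀ r : R, δ' (algebraMap R R[X] r) = (1 : R[X]) ⊗ₜ[R] D (algebraMap R B r) := by
  letI : Differential B := ⟨D⟩
  letI : Algebra R[X] B[X] := Polynomial.algebra R B
  let e : B[X] ≃ₐ[R[X]] R[X] ⊗[R] B := (Algebra.IsPushout.equiv R R[X] B B[X]).symm
  let δ₁ : Derivation ℤ R[X] B[X] := (Differential.mapCoeffs (A := B)).compAlgebraMap R[X]
  refine ⟨e.toLinearMap.compDer δ₁, fun r => ?_⟩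
  change e (Differential.mapCoeffs (A := B) (algebraMap R[X] B[X] (algebraMap R R[X] r))) = _
  rw [Polynomial.algebraMap_apply, Algebra.algebraMap_self, RingHom.id_apply, Polynomial.algebraMap_def,
    Polynomial.coe_mapRingHom, Polynomial.map_C, Differential.mapCoeffs_C]
  change e (Polynomial.C (D (algebraMap R B r))) = _
  have hC : Polynomial.C (D (algebraMap R B r)) = algebraMap B B[X] (D (algebraMap R B r)) := by
    rw [Polynomial.algebraMap_apply, Algebra.algebraMap_self, RingHom.id_apply]
  rw [hC]
  exact Algebra.IsPushout.equiv_symm_algebraMap_right R R[X] B B[X] _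

end Coefficientwise

/-! ## The derivation of a radical step -/

section RadicalStep

variable (R : Type u) [CommRing R] [IsRegularLocalRing R] [IsAdicComplete (maximalIdeal R) R]
  (Q : Ideal R[X]) [Q.IsPrime] (K : Type u) [Field K] [Algebra R K] [IsFractionRing R K]
  (p : ℕ) [Fact p.Prime]

include K in
/-- **The derivation needed for a radical step** (Stacks 07PR with base `R[x]`): for a finite
extension `F` of `K = Frac R` of characteristic `p` and `a ∈ F ∖ F^p`, the ring `F ⊗_R (R[x]_Q)^`
carries a derivation `𝔇` with `𝔇(a)` a unit. Proof as in `exists_derivation_tensor_completion_isUnit`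
(`FormalFibresRegularDerivations.lean`): a finite `R`-subalgebra `B ⊆ F` with `Frac B = F` and
`b₀ = r^p a ∈ B`; Stacks 07PH (`Stacks07PH_finite_regular_holds`) gives `D ∈ Der(B)` with
`D(b₀) ≠ 0`; transport `D` (`exists_derivation_polynomial_extend`,
`exists_derivation_tensor_completion_of_extend`); `𝔇(a) = r^{-p} D(b₀)` is a unit.
[cite: StacksProject, Tag 07PR (proof)] -/
theorem exists_derivation_tensor_completion_polynomial_isUnit
    (F : Type u) [Field F] [Algebra K F] [Algebra R F] [IsScalarTower R K F]
    [FiniteDimensional K F] [CharP F p] (a : F) (ha : ∀ c : F, c ^ p ≠ a) :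
    ∃ 𝔇 : Derivation ℤ (F ⊗[R] CompletionAtPrime R[X] Q) (F ⊗[R] CompletionAtPrime R[X] Q),
      IsUnit (𝔇 (algebraMap F (F ⊗[R] CompletionAtPrime R[X] Q) a)) := by
  haveI : IsDomain R := isDomain_of_isRegularLocalRing R
  have hp : p.Prime := Fact.out
  have hinjF : Function.Injective (algebraMap R F) := by
    rw [IsScalarTower.algebraMap_eq R K F]
    exact (algebraMap K F).injective.comp (IsFractionRing.injective R K)
  obtain ⟨B, hfin, hfrac, r, hr, hra⟩ := exists_finite_subalgebra_isFractionRing R K F a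
  haveI := hfin
  haveI := hfrac
  -- `b₀ = r^p a ∈ B`
  have hb₀mem : r ^ p • a ∈ B := by
    have h := B.smul_mem hra (r ^ (p - 1))
    rwa [smul_smul, ← pow_succ, Nat.sub_add_cancel hp.one_le] at h
  set b₀ : B := ⟨r ^ p • a, hb₀mem⟩ with hb₀def
  have hrF : algebraMap R F r ≠ 0 := (map_ne_zero_iff _ hinjF).mpr hr
  have hb₀F : (b₀ : F) = algebraMap R F r ^ p * a := by
    change r ^ p • a = _
    rw [Algebra.smul_def, map_pow]
  -- hypotheses of the named fact
  haveI : CharP B p := (algebraMap B F).charP Subtype.val_injective p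
  have hinjB : Function.Injective (algebraMap R B) := fun x y hxy =>
    hinjF (by simpa using congrArg (fun b : B => (b : F)) hxy)
  have hnot : ∀ x : FractionRing B, x ^ p ≠ algebraMap B (FractionRing B) b₀ := by
    intro x hx
    let e : FractionRing B ≃ₐ[B] F := FractionRing.algEquiv B F
    have hx' : (e x) ^ p = (b₀ : F) := by
      rw [← map_pow, hx, AlgEquiv.commutes]
      rfl
    refine ha (e x * (algebraMap R F r)⁻¹) ?_
    rw [mul_pow, hx', hb₀F, inv_pow, mul_comm, ← mul_assoc, inv_mul_cancel₀ (pow_ne_zero _ hrF),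
      one_mul]
  -- the named fact
  obtain ⟨D, hD⟩ := Stacks07PH_finite_regular_holds p R B hinjB b₀ hnot
  obtain ⟨δ', hδ'⟩ := exists_derivation_polynomial_extend R B D
  obtain ⟨𝔇, h𝔇⟩ := exists_derivation_tensor_completion_of_extend R R[X] Q F B D δ' hδ'
  refine ⟨𝔇, ?_⟩
  -- `𝔇(b₀)` is a unit
  have hDb₀ : ((D b₀ : B) : F) ≠ 0 := fun h => hD (Subtype.val_injective (by simpa using h))
  have hunit₀ : IsUnit (𝔇 (algebraMap F (F ⊗[R] CompletionAtPrime R[X] Q) (b₀ : F))) := by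
    rw [Algebra.TensorProduct.algebraMap_apply, Algebra.algebraMap_self, RingHom.id_apply, h𝔇 b₀]
    exact ((isUnit_iff_ne_zero.mpr hDb₀).map
      (algebraMap F (F ⊗[R] CompletionAtPrime R[X] Q)) : _)
  -- `p = 0` in `F ⊗ Ŝ`
  have hpE : (p : F ⊗[R] CompletionAtPrime R[X] Q) = 0 := by
    rw [← map_natCast (algebraMap F (F ⊗[R] CompletionAtPrime R[X] Q)), CharP.cast_eq_zero, map_zero]
  -- `a = r^{-p} b₀`
  set u : F ⊗[R] CompletionAtPrime R[X] Q :=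
    algebraMap F (F ⊗[R] CompletionAtPrime R[X] Q) (algebraMap R F r)⁻¹ with hu
  have hau : algebraMap F (F ⊗[R] CompletionAtPrime R[X] Q) a =
      u ^ p * algebraMap F (F ⊗[R] CompletionAtPrime R[X] Q) (b₀ : F) := by
    rw [hu, ← map_pow, ← map_mul, hb₀F, ← mul_assoc, ← mul_pow, inv_mul_cancel₀ hrF, one_pow,
      one_mul]
  have hzero : p • (u ^ (p - 1) • 𝔇 u) = 0 := by
    rw [nsmul_eq_mul, hpE, zero_mul]
  have huunit : IsUnit u :=
    (isUnit_iff_ne_zero.mpr (inv_ne_zero hrF)).map (algebraMap F (F ⊗[R] CompletionAtPrime R[X] Q))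
  rw [hau, Derivation.leibniz, Derivation.leibniz_pow, hzero, smul_zero, add_zero, smul_eq_mul]
  exact (huunit.pow p).mul hunit₀


end RadicalStep

end IntInstances

/-! ## Assembly: `L ⊗_A (A[x]_Q)^` is regular -/

section Assembly

variable (A : Type u) [CommRing A] [IsRegularLocalRing A] (Q : Ideal A[X]) [Q.IsPrime]
  (K : Type u) [Field K] [Algebra A K] [IsFractionRing A K]

/-- The derivation of a radical step, re-packaged with the default `ℤ`-structures of `F ⊗_A Ŝ`
(all `ℤ`-module structures on an abelian group agree). [cite: StacksProject, Tag 07PR (proof)] -/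
theorem exists_derivation_radicalStep_polynomial [IsAdicComplete (maximalIdeal A) A] (p : ℕ)
    [Fact p.Prime] (F : Type u) [Field F] [Algebra K F] [Algebra A F] [IsScalarTower A K F]
    [FiniteDimensional K F] [CharP F p] (a : F) (ha : ∀ c : F, c ^ p ≠ a) :
    ∃ 𝔇 : Derivation ℤ (F ⊗[A] CompletionAtPrime A[X] Q) (F ⊗[A] CompletionAtPrime A[X] Q),
      IsUnit (𝔇 (algebraMap F (F ⊗[A] CompletionAtPrime A[X] Q) a)) := by
  obtain ⟨𝔇₀, h𝔇₀⟩ := exists_derivation_tensor_completion_polynomial_isUnit A Q K p F a ha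
  refine ⟨Derivation.mk' 𝔇₀.toLinearMap.toAddMonoidHom.toIntLinearMap fun x y => ?_, h𝔇₀⟩
  change 𝔇₀ (x * y) = x • 𝔇₀ y + y • 𝔇₀ x
  rw [Derivation.leibniz]

/-- **`K ⊗_A (A[x]_Q)^` is a regular ring** for a regular local ring `A` with fraction field `K`
(Stacks 07PR, base case: `A[x]_Q` is regular local, its completion `Ŝ` is regular, and
`K ⊗_A Ŝ` is the localisation of `Ŝ` at `A ∖ 0`). [cite: StacksProject, Tag 07PR (proof)] -/
theorem isRegularRing_fractionRing_tensor_completion_polynomial :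
    IsRegularRing (K ⊗[A] CompletionAtPrime A[X] Q) := by
  haveI : IsRegularRing A := isRegularRing_of_isRegularLocalRing A
  haveI : IsRegularLocalRing (Localization.AtPrime Q) :=
    IsRegularRing.isRegularLocalRing_localization Q
  haveI : IsRegularRing (CompletionAtPrime A[X] Q) :=
    isRegularRing_adicCompletion (Localization.AtPrime Q)
  haveI : IsLocalization
      (Algebra.algebraMapSubmonoid (CompletionAtPrime A[X] Q) (nonZeroDivisors A))
      (CompletionAtPrime A[X] Q ⊗[A] K) :=
    IsLocalization.tensor K (nonZeroDivisors A)
  haveI : IsRegularRing (CompletionAtPrime A[X] Q ⊗[A] K) :=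
    isRegularRing_of_isLocalization
      (Algebra.algebraMapSubmonoid (CompletionAtPrime A[X] Q) (nonZeroDivisors A)) _
  exact IsRegularRing.of_ringEquiv
    (Algebra.TensorProduct.comm A (CompletionAtPrime A[X] Q) K).toRingEquiv

/-- **Stacks 07PR for polynomial rings: `L ⊗_A (A[x]_Q)^` is a regular ring** for a complete
regular local ring `A`, a prime `Q` of `A[x]` and a finite extension `L` of `K = Frac A` (tower
argument `isRegularRing_tensor_of_derivations` with the base case and the radical steps above).
[cite: StacksProject, Tag 07PR] -/
theorem isRegularRing_tensor_completion_polynomial [IsAdicComplete (maximalIdeal A) A]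
    (L : Type u) [Field L] [Algebra K L] [FiniteDimensional K L] [Algebra A L]
    [IsScalarTower A K L] : IsRegularRing (L ⊗[A] CompletionAtPrime A[X] Q) := by
  haveI := isRegularRing_fractionRing_tensor_completion_polynomial A Q K
  refine isRegularRing_tensor_of_derivations A K L (CompletionAtPrime A[X] Q) ?_
  intro p _ _ F a ha
  haveI : CharP F p := charP_of_injective_algebraMap (algebraMap K F).injective p
  exact exists_derivation_radicalStep_polynomial A Q K p F a ha

end Assembly

end Literature.AlgebraicGeometry.Resolution

end
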